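import Summits.FinalStateConjecture.FinalStateConjecture.Theorems.PhotonSphereChannelsWindowedShellChannelsNearFarSplit

/-!
# Crux `WindowedShellChannels` (stmt-FinalStateConjecture-14085), line `Sketch` — stub
# `stub_nearFarAdditivity` (piece S4: exact near/far additivity)

For two global classical solutions `ψn`, `ψf` of `ψ_tt − ψ_xx + Vψ = 0` (`V ≥ 0` differentiable)
whose Cauchy data are supported in `(−∞, a)` and `(b, ∞)`, the domain of dependence
(`CauchyWaveGlobal.curried_eq_zero_of_data`) gives `ψn ≡ 0` on `{a + |t| ≤ x}` and `ψf ≡ 0` on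
`{x ≤ b − |t|}`; both vanishing regions have open interiors on which the energy density of the
other summand is the energy density of the sum
(`WindowedShellChannelsSplit.energyDensity_add_of_left/right_vanish`).  The exterior window
`{ρ + |t| < |x − x_c|}` lies in the union of the two open regions as soon as `a ≤ x_c + ρ` and
`x_c − ρ ≤ b`, so the exterior energies of aperture `ρ` about `x_c` ADD at every time, the channel
energies (their `liminf` along any time filter) are super-additive
(`WindowedShellChannelsSplit.add_liminf_le_liminf_add`), and for `a ≤ b` the total energies at
`t = 0` add (the densities add at every `x ≠ a`).

The registered stub is the Regge–Wheeler instance `M = 1`, photon sphere at `0`,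
`r = tortoiseRadius one_pos 0`, `a = −R₀`, `b = R₀`, `x_c = 0`, `ρ = −B₀` with `0 ≤ B₀ ≤ R₀`,
along `atTop`.  No definitions are introduced. [folklore]
-/

noncomputable section

set_option linter.dupNamespace false

open Set Filter Topology Function MeasureTheory
open scoped ENNReal

namespace Summit.FinalStateConjecture.FinalStateConjecture.Theorems.WindowedShellChannelsSketch

open Literature.Geometry.Lorentzian Literature.Geometry.Lorentzian.ReggeWheeler
open Summit.FinalStateConjecture.FinalStateConjecture.Theorems
open Summit.FinalStateConjecture.FinalStateConjecture.Theorems.CauchyWaveGlobal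
open Summit.FinalStateConjecture.FinalStateConjecture.Theorems.WindowedShellChannelsSplit

namespace NearFarAdditivity

variable {V : ℝ → ℝ} {ψn ψf : ℝ → ℝ → ℝ} {a b : ℝ}

/-- **Domain of dependence, near piece.** Data supported in `(−∞, a)` force `ψn(t, x) = 0` for
`a + |t| ≤ x`. [folklore] -/
theorem near_eq_zero (hV : Differentiable ℝ V) (hV0 : ∀ x, 0 ≤ V x) (hψn : IsSolution V ψn)
    (hn : CauchyDataSupportedOn ψn (Iio a)) {t x : ℝ} (hx : a + |t| ≤ x) : ψn t x = 0 := by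
  have hn_data : ∀ z, a ≤ z → ψn 0 z = 0 ∧ deriv (fun τ => ψn τ z) 0 = 0 := fun z hz =>
    hn z (by simpa only [mem_Iio, not_lt] using hz)
  exact curried_eq_zero_of_data hV hV0 hψn (a := a) (b := x + |t|)
    (fun w hw => (hn_data w hw.1).1) (fun w hw => (hn_data w hw.1).2) hx (by linarith)

/-- **Domain of dependence, far piece.** Data supported in `(b, ∞)` force `ψf(t, x) = 0` for
`x ≤ b − |t|`. [folklore] -/
theorem far_eq_zero (hV : Differentiable ℝ V) (hV0 : ∀ x, 0 ≤ V x) (hψf : IsSolution V ψf)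
    (hf : CauchyDataSupportedOn ψf (Ioi b)) {t x : ℝ} (hx : x ≤ b - |t|) : ψf t x = 0 := by
  have hf_data : ∀ z, z ≤ b → ψf 0 z = 0 ∧ deriv (fun τ => ψf τ z) 0 = 0 := fun z hz =>
    hf z (by simpa only [mem_Ioi, not_lt] using hz)
  exact curried_eq_zero_of_data hV hV0 hψf (a := x - |t|) (b := b)
    (fun w hw => (hf_data w hw.2).1) (fun w hw => (hf_data w hw.2).2) (by linarith) hx

/-- **Pointwise splitting of the energy density** of `ψn + ψf` on the union of the two open
vanishing regions `{a + |t| < x}` (where it is `e[ψf]` and `e[ψn] = 0`) and `{x < b − |t|}`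
(where it is `e[ψn]` and `e[ψf] = 0`). [folklore] -/
theorem energyDensity_add_eq (hV : Differentiable ℝ V) (hV0 : ∀ x, 0 ≤ V x)
    (hψn : IsSolution V ψn) (hψf : IsSolution V ψf) (hn : CauchyDataSupportedOn ψn (Iio a))
    (hf : CauchyDataSupportedOn ψf (Ioi b)) {t x : ℝ} (hx : a + |t| < x ∨ x < b - |t|) :
    energyDensity V (fun t x => ψn t x + ψf t x) t x
      = energyDensity V ψn t x + energyDensity V ψf t x := by
  have hCn : ContDiff ℝ 2 (uncurry ψn) := hψn.1
  have hCf : ContDiff ℝ 2 (uncurry ψf) := hψf.1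
  have h1 : (fun t x => ψn t x + ψf t x) = fun t x => 1 * ψn t x + 1 * ψf t x := by
    funext τ z
    rw [one_mul, one_mul]
  rw [h1]
  rcases hx with hx | hx
  · have hev : ∀ᶠ w in 𝓝 (t, x), uncurry ψn w = 0 := by
      have ho : IsOpen {w : ℝ × ℝ | a + |w.1| < w.2} := isOpen_lt (by fun_prop) (by fun_prop)
      filter_upwards [ho.mem_nhds (show (t, x) ∈ {w : ℝ × ℝ | a + |w.1| < w.2} from hx)]
        with w hw
      exact near_eq_zero hV hV0 hψn hn (le_of_lt hw)
    obtain ⟨h0, h1', h2⟩ := firstOrder_vanish_of_eventually hev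
    rw [energyDensity_add_of_left_vanish hCn hCf h0 h1' h2,
      energyDensity_eq_zero_of_vanish h0 h1' h2, zero_add]
  · have hev : ∀ᶠ w in 𝓝 (t, x), uncurry ψf w = 0 := by
      have ho : IsOpen {w : ℝ × ℝ | w.2 < b - |w.1|} := isOpen_lt (by fun_prop) (by fun_prop)
      filter_upwards [ho.mem_nhds (show (t, x) ∈ {w : ℝ × ℝ | w.2 < b - |w.1|} from hx)]
        with w hw
      exact far_eq_zero hV hV0 hψf hf (le_of_lt hw)
    obtain ⟨h0, h1', h2⟩ := firstOrder_vanish_of_eventually hev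
    rw [energyDensity_add_of_right_vanish hCn hCf h0 h1' h2,
      energyDensity_eq_zero_of_vanish h0 h1' h2, add_zero]

/-- **Exterior energies add at every time** for a window `{ρ + |t| < |x − x_c|}` contained in the
union of the two vanishing regions (`a ≤ x_c + ρ`, `x_c − ρ ≤ b`). [folklore] -/
theorem exteriorEnergy_add_eq (hV : Differentiable ℝ V) (hV0 : ∀ x, 0 ≤ V x)
    (hψn : IsSolution V ψn) (hψf : IsSolution V ψf) (hn : CauchyDataSupportedOn ψn (Iio a))
    (hf : CauchyDataSupportedOn ψf (Ioi b)) {xc ρ : ℝ} (ha : a ≤ xc + ρ) (hb : xc - ρ ≤ b)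
    (t : ℝ) :
    exteriorEnergy V xc ρ (fun t x => ψn t x + ψf t x) t
      = exteriorEnergy V xc ρ ψn t + exteriorEnergy V xc ρ ψf t := by
  unfold exteriorEnergy
  have hmeas : MeasurableSet {x : ℝ | ρ + |t| < |x - xc|} :=
    (isOpen_lt continuous_const (by fun_prop)).measurableSet
  rw [← lintegral_add_left (measurable_energyDensity hV.continuous hψn.1 t)]
  refine setLIntegral_congr_fun hmeas fun y hy => ?_
  simp only [mem_setOf_eq] at hy
  have hy' : a + |t| < y ∨ y < b - |t| := by
    rcases le_or_gt 0 (y - xc) with hs | hs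
    · rw [abs_of_nonneg hs] at hy; left; linarith
    · rw [abs_of_neg hs] at hy; right; linarith
  rw [energyDensity_add_eq hV hV0 hψn hψf hn hf hy',
    ENNReal.ofReal_add (energyDensity_nonneg _ _ (hV0 y)) (energyDensity_nonneg _ _ (hV0 y))]

/-- **Channel energies are super-additive** (along any time filter) for a window contained in the
union of the two vanishing regions. [folklore] -/
theorem add_channelEnergy_le (hV : Differentiable ℝ V) (hV0 : ∀ x, 0 ≤ V x)
    (hψn : IsSolution V ψn) (hψf : IsSolution V ψf) (hn : CauchyDataSupportedOn ψn (Iio a))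
    (hf : CauchyDataSupportedOn ψf (Ioi b)) {xc ρ : ℝ} (ha : a ≤ xc + ρ) (hb : xc - ρ ≤ b)
    (l : Filter ℝ) :
    channelEnergy V xc ρ ψn l + channelEnergy V xc ρ ψf l
      ≤ channelEnergy V xc ρ (fun t x => ψn t x + ψf t x) l := by
  unfold channelEnergy
  rw [show exteriorEnergy V xc ρ (fun t x => ψn t x + ψf t x)
      = fun t => exteriorEnergy V xc ρ ψn t + exteriorEnergy V xc ρ ψf t from
      funext (exteriorEnergy_add_eq hV hV0 hψn hψf hn hf ha hb)]
  exact add_liminf_le_liminf_add l _ _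

/-- **Total energies add at `t = 0`** when the data have disjoint supports (`a ≤ b`): the energy
densities add at every `x ≠ a`. [folklore] -/
theorem totalEnergy_add_eq (hV : Differentiable ℝ V) (hV0 : ∀ x, 0 ≤ V x)
    (hψn : IsSolution V ψn) (hψf : IsSolution V ψf) (hn : CauchyDataSupportedOn ψn (Iio a))
    (hf : CauchyDataSupportedOn ψf (Ioi b)) (hab : a ≤ b) :
    totalEnergy V (fun t x => ψn t x + ψf t x) 0 = totalEnergy V ψn 0 + totalEnergy V ψf 0 := by
  unfold totalEnergy
  rw [← lintegral_add_left (measurable_energyDensity hV.continuous hψn.1 0)]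
  refine lintegral_congr_ae ?_
  filter_upwards [Measure.ae_ne volume a] with y hy
  have hy' : a + |(0 : ℝ)| < y ∨ y < b - |(0 : ℝ)| := by
    rw [abs_zero, add_zero, sub_zero]
    rcases lt_or_gt_of_ne hy with h | h
    · right; exact lt_of_lt_of_le h hab
    · left; exact h
  rw [energyDensity_add_eq hV hV0 hψn hψf hn hf hy',
    ENNReal.ofReal_add (energyDensity_nonneg _ _ (hV0 y)) (energyDensity_nonneg _ _ (hV0 y))]

end NearFarAdditivity

/-- **Registered stub `stub_nearFarAdditivity`** (crux `WindowedShellChannels`, line `Sketch`,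
piece S4, item stmt-FinalStateConjecture-14085).  Exact near/far additivity of the lagged forward
channel: for two Regge–Wheeler solutions (unit mass, photon sphere at `0`) whose data are supported
in `(−∞, −R₀)` and `(R₀, ∞)` and a lag `0 ≤ B₀ ≤ R₀`, the forward channel energies of aperture
`−B₀` about `0` are super-additive and the energies at `t = 0` add. [folklore] -/
theorem stub_nearFarAdditivity (s ℓ : ℕ) (hsℓ : s ≤ ℓ) : ∀ R₀ B₀ : ℝ, 0 ≤ B₀ → B₀ ≤ R₀ →
    ∀ ψn ψf : ℝ → ℝ → ℝ, IsRWSolution 1 s ℓ (tortoiseRadius one_pos 0) ψn → IsRWSolution 1 s ℓ (tortoiseRadius one_pos 0) ψf →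
      CauchyDataSupportedOn ψn (Iio (-R₀)) → CauchyDataSupportedOn ψf (Ioi R₀) →
      channelEnergy (linePotential 1 s ℓ (tortoiseRadius one_pos 0)) 0 (-B₀) ψn atTop
          + channelEnergy (linePotential 1 s ℓ (tortoiseRadius one_pos 0)) 0 (-B₀) ψf atTop
        ≤ channelEnergy (linePotential 1 s ℓ (tortoiseRadius one_pos 0)) 0 (-B₀) (fun t x => ψn t x + ψf t x) atTop ∧
      totalEnergy (linePotential 1 s ℓ (tortoiseRadius one_pos 0)) (fun t x => ψn t x + ψf t x) 0
        = totalEnergy (linePotential 1 s ℓ (tortoiseRadius one_pos 0)) ψn 0 + totalEnergy (linePotential 1 s ℓ (tortoiseRadius one_pos 0)) ψf 0 := by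
  intro R₀ B₀ hB₀ hBR ψn ψf hψn hψf hn hf
  have hr : IsTortoiseRadius 1 (tortoiseRadius one_pos 0) 0 :=
    isTortoiseRadius_tortoiseRadius one_pos 0
  have hVd : Differentiable ℝ (linePotential 1 s ℓ (tortoiseRadius one_pos 0)) :=
    RW.differentiable_linePotential hr s ℓ
  have hV0 : ∀ x, 0 ≤ linePotential 1 s ℓ (tortoiseRadius one_pos 0) x := fun x =>
    (RW.linePotential_pos hr hsℓ x).le
  exact ⟨NearFarAdditivity.add_channelEnergy_le hVd hV0 hψn hψf hn hf (by linarith) (by linarith)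
      atTop,
    NearFarAdditivity.totalEnergy_add_eq hVd hV0 hψn hψf hn hf (by linarith)⟩

end Summit.FinalStateConjecture.FinalStateConjecture.Theorems.WindowedShellChannelsSketch

end
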